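import Summits.BirchSwinnertonDyer.BirchSwinnertonDyer.Theorems.ByReductionTypeAtTwoOrdKatoHalfAtTwoIsoConjATwoOfPointFieldMu
import Literature.NumberTheory.EllipticCurves.FineSelmerPExtensionDescentProofs
import HarnessLib
/-!
# Route `ByReductionTypeAtTwo` (K4), crux 202 `OrdKatoHalfAtTwoIso` (stmt-BirchSwinnertonDyer-19573), line `steinberg-fibre-at-two`:
# statement (A) at `2` DOWNSTAIRS from Iwasawa's classical `μ₂ = 0` of ANY totally complex carrier over which `E[2]` is unipotent —
# the honest kernel scope of Lim 2017 Thm. 3.5 at `p = 2` (KERNEL; theorems only)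

Seat `cruxlead-stmt-BirchSwinnertonDyer-19573-w2` GEN 7 (prover WIDTH under the LEAD lineage; HOME `run/shared/lean/pub/bsd-2adic/`;
`--supports stmt-BirchSwinnertonDyer-19573`). HONEST FRAMING (cell bsd-2adic): THEOREMS ONLY — no definition, no named fact, no `sorry`;
the crux, its PAIR child 24097, B7′ (23921) and Q⁺ are NOT proved here; the inputs below are Iwasawa's classical `μ₂ = 0` for explicit
number fields (open in general off the abelian case); BSD is not proved by any of this.

WHY. GEN 6 (p717389 + p718233) made the two classical-`μ` supply roads of Q⁺ kernel on the carriers `ℚ(W[2], √−1)` and the sextic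
`ℚ(P, √−1)`; its HANDOFF named the successor item «generic totally-complex downstairs Lim theorem». This file types it: the carrier is
ANY finite `L ⊆ K̄` (not necessarily normal over `K`) which is TOTALLY COMPLEX and over which `res(Γ_L)` acts on `E[2]` UNIPOTENTLY (a flag
`0 ⊂ C ⊂ E[2]` fixed pointwise with trivial action on `E[2]/C`) — e.g. every totally complex `L ⊆ K(E[n])`, `2 ∣ n`, of `2`-power index
(§2: the image of `res(Γ_L)` in `Aut E[2]` is then a `2`-group, which fixes a flag — bsd-potss-rkm g33's `exists_flag_of_isPGroup`), in
particular the `2`-division field `K(E[2])` itself whenever it is totally complex (over `ℚ`: `Δ_E < 0`, §3). Compared with p718233 §2 the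
normal subgroup through which Lim's Lemma 3.2 descent is bounded is `N = Gal(K̄/L̃) ⊓ ker χ₂`, `L̃` the normal closure of `L` (instead of
`ker ρ̄_{E,2} ⊓ ker χ₂`), so that no hypothesis ties `L` to a division field in §1.

SCOPE (answer to the pen's D-audit ask RC-457 on the downstairs named fact
`Lim2017.thm35_at_two_fineSelmerDual_moduleFinite_of_classicalMuVanishes_of_le_divisionField_four`, which carries NO archimedean guard):
the kernel proves it for TOTALLY COMPLEX `L` (§3 `thm35_at_two_of_le_divisionField_four_of_isTotallyComplex`, verbatim its binders plus the
guard). At a carrier with a real place the printed/kernel argument leaks at the real places in one of two ways — for `0 < Δ_E` at the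
coefficient step `Sel₀(E[2]) → Sel₀(E[2^∞])[2]` (`E(ℝ)/2E(ℝ) ≠ 0`: the tree's `hinf` of
`FineSelmerCoefficientMap.finite_fineSelmerInfty_pTorsion_of_finite_torsion_of_forall_infinitePlace` fails), for `Δ_E < 0` in the
dévissage along the flag (complex conjugation is a transposition on `E[2]`, so the kernel classes are relaxed at the real places) — and
what is then needed is a NARROW-type `μ₂`, which `ClassicalMuVanishes` (wide class numbers) does not control. Nothing is asserted about
those carriers here.

* §1 (any number field `K`, `E = W/K` elliptic, `p = 2`) **`finite_twoTorsion_fineRelaxed_of_classicalMu_of_unipotent`** —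
  `Sel₀^{rel ∞}(K_∞, E[2^∞])[2]` finite (the RELAXED-at-`∞` currency of B7′'s `μ`-doors) from `ClassicalMuVanishes` of the cyclotomic
  `ℤ₂`-extension(s) of a totally complex `L` carrying a unipotent flag; **`finite_twoTorsion_fineSelmer_of_classicalMu_of_unipotent`**
  (strict) and **`exists_fineSelmerDualData_moduleFinite_of_classicalMu_of_unipotent`** (the `∃ γ D` form of statement (A) at `(E, 2)`).
* §2 **`exists_flag_of_le_divisionField`** — for `L ≤ K(E[n])`, `2 ∣ n`, `[K(E[n]) : L]` a power of `2`, a flag `C` as above EXISTS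
  (`res(Γ_L)` is a conjugate of `Gal(K̄/L) ⊇ Gal(K̄/K(E[n]))`, so its image in `Perm E[2]` has `2`-power order); hence
  **`exists_fineSelmerDualData_moduleFinite_of_classicalMu_of_le_divisionField`** (any even `n`, totally complex `L`) and
  **`…_of_classicalMu_divisionField_two`** (carrier `K(E[2])` itself, `n = 2`, `k = 0`).
* §3 (`K = ℚ`) **`isComplex_infinitePlace_divisionField_two_of_Δ_neg`** (`Δ_E < 0` ⟹ `ℚ(E[2])` totally complex: a real place of
  `ℚ(E[2])` yields a complex conjugation fixing `ℚ(E[2])`, against `FineRoadDiscriminantSign.Δ_neg_iff_not_mem_fixingSubgroup_divisionField`);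
  **`conjA_two_of_classicalMu_divisionField_two_of_Δ_neg`** — statement (A) at `(E, 2)` for EVERY `E/ℚ` with `Δ_E < 0` from `μ₂ = 0` of the
  cyclotomic `ℤ₂`-extension of the (totally complex, at most sextic) field `ℚ(E[2])` ALONE — no `√−1`, no Lim fact, no ascent; and
  **`thm35_at_two_of_le_divisionField_four_of_isTotallyComplex`** — the downstairs named fact's statement with the guard
  «every infinite place of `L` is complex» PROVED.

References: [Lim2017FineSelmer] M. F. Lim, Asian J. Math. 21 (2017) = arXiv:1306.2047, §3 Thm. 3.5, Lemma 3.2, proof of Thm. 3.1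
(«so that `F` contains `μ_{2p}` (in particular, `F` has no real primes)»); [Iwasawa1973MuInvariants] Thm. 2/3 («let `k` be totally imaginary
if `ℓ = 2`»; the ascent — NOT used); [CoatesSujatha2005] statement (A), §3 Thm. 3.4, Lemma 3.3; [SerreLocalFields1979] IX §1 (fixed points
of `p`-groups); [SilvermanAEC2009] III.1, VIII.§1; [Cox2013] §5.A (real places and complex conjugations); tree p717389, p718233, p716255,
bsd-potss-rkm g33 `FineSelmerPExtensionDescentProofs`, att-p5 `…FineRoadDiscriminantSign`.
-/

set_option autoImplicit false
-- the Theorems namespace of this sub repeats the summit name by design (D-0017 nested layout)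
set_option linter.dupNamespace false

noncomputable section

open scoped Classical

namespace Summit.BirchSwinnertonDyer.BirchSwinnertonDyer.Theorems.SteinbergFibreAtTwo.TotallyComplexMu

open WeierstrassCurve NumberField IsDedekindDomain Field
open Literature.NumberTheory.EllipticCurves Literature.NumberTheory.EllipticCurves.GreenbergSelmer
  Literature.NumberTheory.GaloisRepresentations Literature.NumberTheory.IwasawaTheory
  Literature.NumberTheory.EllipticCurves.Rank1Residual
  Literature.NumberTheory.GaloisRepresentations.LocalWeilDatum
open Summit.BirchSwinnertonDyer.BirchSwinnertonDyer.Theorems.AlignedTransportAtTwoFineRoad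

/-! ## §1 Any totally complex carrier with a unipotent flag -/

section Core

variable {K : Type} [Field K] [NumberField K] (W : WeierstrassCurve K) [W.IsElliptic]

/-- **`Sel₀^{rel ∞}(K_∞, E[2^∞])[2]` is finite from `μ₂(L^{cyc}) = 0` for ANY totally complex carrier `L` over which `E[2]` is unipotent.**
`K` a number field, `E = W/K` elliptic, `L ⊆ K̄` a finite extension of `K` (not necessarily normal) all of whose infinite places are complex,
`C ≤ E[2]` a subgroup fixed pointwise by `res(Γ_L)` with `res(Γ_L)` acting trivially on `E[2]/C`; if every cyclotomic `ℤ₂`-extension of `L`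
has Iwasawa's classical `μ = 0` (growth form), then for every cyclotomic `ℤ₂`-extension `κ` of `K` the `2`-torsion of the RELAXED-at-`∞`
fine Selmer group of `E[2^∞]` over `K_∞` is finite. Chain: upstairs prime-wise finiteness over `Ω = galImage(ker κ_L)`
(`FineSelmerUpstairs.finite_primewiseFine_pTorsion_galImage_of_unipotent`, p717389: dévissage along the flag over the totally complex `L`,
no ascent) → Lim's Lemma 3.2 descent for the non-normal `Ω` (`PointFieldMu.finite_pTorsion_fineRelaxed_of_primewise_upstairs`, p718233)
bounded through the NORMAL subgroup `N = Gal(K̄/L̃) ⊓ ker χ₂`, `L̃` the normal closure of `L` in `K̄` (finite Galois, so `N` has finite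
index in `ker κ`; an element of `N` fixes every `K`-embedding of `L` and has `χ₂ = 1 ∈ μ(ℤ₂)`, hence lies in `Ω`).
[cite: Lim2017FineSelmer, §3 Thm. 3.5 and Lemma 3.2 (arXiv:1306.2047 pp. 6–7)] [cite: CoatesSujatha2005, statement (A), §3 Thm. 3.4 and Lemma 3.3]
[cite: Iwasawa1973MuInvariants, §1 (the input μ = 0; Thm. 2/3 NOT used)] -/
theorem finite_twoTorsion_fineRelaxed_of_classicalMu_of_unipotent
    (L : IntermediateField K (AlgebraicClosure K)) [FiniteDimensional K L]
    (hLc : ∀ w : InfinitePlace L, w.IsComplex)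
    (C : AddSubgroup (geomTorsion W ((2 : ℕ) : ℤ)))
    (hC1 : ∀ (σ : absoluteGaloisGroup L) (Q : geomTorsion W ((2 : ℕ) : ℤ)), Q ∈ C → resGal (K := K) L σ • Q = Q)
    (hC2 : ∀ (σ : absoluteGaloisGroup L) (Q : geomTorsion W ((2 : ℕ) : ℤ)), resGal (K := K) L σ • Q - Q ∈ C)
    (hμ : ∀ κL : ZpExtension L 2, κL.IsCyclotomic → ClassicalMuVanishes κL)
    (κ : ZpExtension K 2) (hκ : κ.IsCyclotomic) :
    Set.Finite {s : W.fineSelmerInftyRelaxedInf κ | 2 • s = 0} := by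
  haveI : Fact (Nat.Prime 2) := ⟨Nat.prime_two⟩
  haveI : NeZero ((2 : ℕ) : K) := ⟨by exact_mod_cast (two_ne_zero : (2 : K) ≠ 0)⟩
  haveI : NumberField L := NumberField.of_module_finite K L
  haveI : Algebra.IsAlgebraic K L := Algebra.IsAlgebraic.of_finite K L
  haveI : IsGalois K (AlgebraicClosure K) := {}
  -- a cyclotomic `ℤ₂`-extension of `L`
  obtain ⟨κL, hκL⟩ := ZpExtension.exists_isCyclotomic_holds L 2 (GaloisRep.cyclotomicCharacter_range_infinite _ 2)
  -- upstairs, prime-wise, over `Ω = galImage(ker κ_L)`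
  have hup := FineSelmerUpstairs.finite_primewiseFine_pTorsion_galImage_of_unipotent W hLc C hC1 hC2 κL hκL (hμ κL hκL)
  -- `Ω ≤ ker κ`
  have hkerL := FineSelmerFiniteOfUnramifiedClasses.kerSubgroup_eq_comap_of_isCyclotomic κ hκ κL hκL
  have hΩ : BaseChangeModel.galImage K L κL.kerSubgroup ≤ κ.kerSubgroup := by
    unfold BaseChangeModel.galImage
    rw [resGal_eq_absGaloisRestrict, hkerL]
    exact Subgroup.map_comap_le _ _
  -- the normal closure `L̃` of `L` in `K̄` and `N = Gal(K̄/L̃) ⊓ ker χ₂`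
  haveI : FiniteDimensional K (IntermediateField.normalClosure K L (AlgebraicClosure K)) := inferInstance
  haveI : Normal K (IntermediateField.normalClosure K L (AlgebraicClosure K)) := inferInstance
  haveI : IsGalois K (IntermediateField.normalClosure K L (AlgebraicClosure K)) := {}
  set Lt : IntermediateField K (AlgebraicClosure K) := IntermediateField.normalClosure K L (AlgebraicClosure K) with hLt
  have hgF : galFixing K Lt = (Lt.fixingSubgroup : Subgroup (absoluteGaloisGroup K)) := by
    ext σ
    rw [mem_galFixing_iff]
    exact (IntermediateField.mem_fixingSubgroup_iff Lt (absoluteGaloisGroup.toAlgEquiv K σ)).symm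
  haveI hLtn : (galFixing K Lt).Normal := by
    rw [hgF]
    exact (InfiniteGalois.normal_iff_isGalois Lt).mpr inferInstance
  set N : Subgroup (absoluteGaloisGroup K) :=
    galFixing K Lt ⊓ (GaloisRep.cyclotomicCharacter K 2).toMonoidHom.ker with hN
  haveI : N.Normal := inferInstance
  -- `N` has finite index in `ker κ`
  have hind : (N.subgroupOf κ.kerSubgroup).FiniteIndex := by
    haveI h1 : (galFixing K Lt).FiniteIndex := by
      refine ⟨?_⟩
      have h3 : (galFixing K Lt).index = Module.finrank K Lt := by
        rw [hgF]; exact (IntermediateField.finrank_eq_fixingSubgroup_index Lt).symm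
      rw [h3]
      exact Module.finrank_pos.ne'
    haveI h2 : ((galFixing K Lt).subgroupOf κ.kerSubgroup).FiniteIndex := inferInstance
    haveI h3 := InfRes.finiteIndex_ker_cyclotomicCharacter κ hκ
    have h : N.subgroupOf κ.kerSubgroup = (galFixing K Lt).subgroupOf κ.kerSubgroup ⊓
        ((GaloisRep.cyclotomicCharacter K 2).toMonoidHom.ker).subgroupOf κ.kerSubgroup := by
      ext x
      simp only [hN, Subgroup.mem_subgroupOf, Subgroup.mem_inf]
    rw [h]
    infer_instance
  -- `N ≤ Ω`
  obtain ⟨e, he⟩ := exists_mem_range_absGaloisRestrict_iff K L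
  have hNΩ : N ≤ BaseChangeModel.galImage K L κL.kerSubgroup := by
    intro g hg
    obtain ⟨hgL, hχ⟩ := Subgroup.mem_inf.1 hg
    rw [MonoidHom.mem_ker] at hχ
    change GaloisRep.cyclotomicCharacter K 2 g = 1 at hχ
    -- `g` fixes `e(L) ⊆ L̃`
    have hrange : g ∈ (absGaloisRestrict K L).range := by
      refine (he g).2 fun y ↦ ?_
      have hy : (e y : AlgebraicClosure K) ∈ Lt := by
        rw [hLt]
        exact AlgHom.fieldRange_le_normalClosure e ⟨y, rfl⟩
      exact (mem_galFixing_iff K).1 hgL _ hy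
    unfold BaseChangeModel.galImage
    rw [resGal_eq_absGaloisRestrict, hkerL]
    change g ∈ Subgroup.map (absGaloisRestrict K L).toMonoidHom
      (Subgroup.comap (absGaloisRestrict K L).toMonoidHom κ.kerSubgroup)
    rw [Subgroup.map_comap_eq]
    refine Subgroup.mem_inf.2 ⟨hrange, ?_⟩
    rw [show κ.kerSubgroup = _ from hκ, Subgroup.mem_comap]
    change GaloisRep.cyclotomicCharacter K 2 g ∈ CommGroup.torsion ℤ_[2]ˣ
    rw [hχ]
    exact (CommGroup.torsion ℤ_[2]ˣ).one_mem
  -- descend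
  exact PointFieldMu.finite_pTorsion_fineRelaxed_of_primewise_upstairs W 2 κ hNΩ hΩ hind hup

/-- **`Sel₀(K_∞, E[2^∞])[2]` (STRICT at `∞`) is finite** under the hypotheses of
`finite_twoTorsion_fineRelaxed_of_classicalMu_of_unipotent` (`Sel₀ ≤ Sel₀^{rel ∞}`, `LimRelUpstairs.finite_pTorsion_fineSelmer_of_relaxed`).
[cite: Lim2017FineSelmer, §3 Thm. 3.5 and Lemma 3.2] [cite: GreenbergLNM1716, §4 (PDF p. 106)] -/
theorem finite_twoTorsion_fineSelmer_of_classicalMu_of_unipotent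
    (L : IntermediateField K (AlgebraicClosure K)) [FiniteDimensional K L]
    (hLc : ∀ w : InfinitePlace L, w.IsComplex)
    (C : AddSubgroup (geomTorsion W ((2 : ℕ) : ℤ)))
    (hC1 : ∀ (σ : absoluteGaloisGroup L) (Q : geomTorsion W ((2 : ℕ) : ℤ)), Q ∈ C → resGal (K := K) L σ • Q = Q)
    (hC2 : ∀ (σ : absoluteGaloisGroup L) (Q : geomTorsion W ((2 : ℕ) : ℤ)), resGal (K := K) L σ • Q - Q ∈ C)
    (hμ : ∀ κL : ZpExtension L 2, κL.IsCyclotomic → ClassicalMuVanishes κL)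
    (κ : ZpExtension K 2) (hκ : κ.IsCyclotomic) :
    Set.Finite {s : W.fineSelmerInfty κ | 2 • s = 0} :=
  haveI : Fact (Nat.Prime 2) := ⟨Nat.prime_two⟩
  LimRelUpstairs.finite_pTorsion_fineSelmer_of_relaxed W κ
    (finite_twoTorsion_fineRelaxed_of_classicalMu_of_unipotent W L hLc C hC1 hC2 hμ κ hκ)

/-- **Statement (A) at `(E, 2)` DOWNSTAIRS, `∃ γ D` form, from `μ₂(L^{cyc}) = 0` for ANY totally complex carrier `L` over which `E[2]` is
unipotent**: for every cyclotomic `ℤ₂`-extension `κ` of `K` some fine Selmer dual datum of `E` over `K_∞` is finitely generated over `ℤ₂`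
(`IwasawaModuleFinitePadicInt.exists_fineSelmerDualData_moduleFinite_iff_finite_pTorsion`). Generalises p718233's
`PointFieldMu.exists_fineSelmerDualData_moduleFinite_of_classicalMu_pointField_adjoin` (carrier `K(P) ⊔ K⟮√−1⟯`) to every admissible carrier.
[cite: Lim2017FineSelmer, §3 Thm. 3.5 and Lemma 3.2] [cite: CoatesSujatha2005, statement (A), Thm. 3.4] -/
theorem exists_fineSelmerDualData_moduleFinite_of_classicalMu_of_unipotent
    (L : IntermediateField K (AlgebraicClosure K)) [FiniteDimensional K L]
    (hLc : ∀ w : InfinitePlace L, w.IsComplex)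
    (C : AddSubgroup (geomTorsion W ((2 : ℕ) : ℤ)))
    (hC1 : ∀ (σ : absoluteGaloisGroup L) (Q : geomTorsion W ((2 : ℕ) : ℤ)), Q ∈ C → resGal (K := K) L σ • Q = Q)
    (hC2 : ∀ (σ : absoluteGaloisGroup L) (Q : geomTorsion W ((2 : ℕ) : ℤ)), resGal (K := K) L σ • Q - Q ∈ C)
    (hμ : ∀ κL : ZpExtension L 2, κL.IsCyclotomic → ClassicalMuVanishes κL)
    (κ : ZpExtension K 2) (hκ : κ.IsCyclotomic) :
    ∃ (γ : absoluteGaloisGroup K) (D : W.FineSelmerDualData κ γ),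
      Module.Finite ℤ_[2] (RestrictScalars ℤ_[2] (IwasawaAlgebra 2) D.X) := by
  haveI : Fact (Nat.Prime 2) := ⟨Nat.prime_two⟩
  obtain ⟨γ₀, hγ₀⟩ : ∃ γ₀ : absoluteGaloisGroup K, κ.IsTopGenerator γ₀ := κ.surjective (Multiplicative.ofAdd 1)
  exact (IwasawaModuleFinitePadicInt.exists_fineSelmerDualData_moduleFinite_iff_finite_pTorsion W κ hγ₀).2
    (finite_twoTorsion_fineSelmer_of_classicalMu_of_unipotent W L hLc C hC1 hC2 hμ κ hκ)

end Core

/-! ## §2 Carriers inside a division field `K(E[n])`, `2 ∣ n`, of `2`-power index -/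

section DivisionField

variable {K : Type} [Field K] [NumberField K] (W : WeierstrassCurve K) [W.IsElliptic]

omit [NumberField K] [W.IsElliptic] in
/-- `Γ_{K(E[n])} ≤ Γ_{K(E[2])}` for `2 ∣ n`: an element fixing `E[n]` pointwise fixes `E[2] ⊆ E[n]` pointwise.
[cite: SilvermanAEC2009, VIII.§1 (action of G_{K̄/K} on E[m])] -/
theorem fixingSubgroupOfModule_geomTorsion_le_of_two_dvd {n : ℕ} (hn : 2 ∣ n) :
    fixingSubgroupOfModule K (geomTorsion W (n : ℤ)) ≤ fixingSubgroupOfModule K (geomTorsion W ((2 : ℕ) : ℤ)) := by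
  intro σ hσ
  rw [W.mem_fixingSubgroupOfModule_geomTorsion_iff] at hσ ⊢
  intro T
  obtain ⟨m, hm⟩ := hn
  have hT2 : ((2 : ℕ) : ℤ) • (T : geomPoints W) = 0 := (W.mem_geomTorsion_iff _ _).1 T.2
  have hTn : (T : geomPoints W) ∈ geomTorsion W (n : ℤ) := by
    rw [W.mem_geomTorsion_iff]
    rw [hm, Nat.cast_mul, mul_comm, mul_smul, hT2, smul_zero]
  have h := hσ ⟨(T : geomPoints W), hTn⟩
  apply Subtype.ext
  rw [AddSubgroup.torsionBy.coe_smul]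
  have h' := congrArg (fun P : geomTorsion W (n : ℤ) ↦ (P : geomPoints W)) h
  simpa only [AddSubgroup.torsionBy.coe_smul] using h'

/-- **A unipotent flag on `E[2]` for every carrier `L ⊆ K(E[n])`, `2 ∣ n`, of `2`-power index.** If `L ≤ K(E[n])` and
`[K(E[n]) : K] = 2^k · [L : K]`, then `res(Γ_L)` — a conjugate `τ Gal(K̄/L) τ⁻¹ ⊇ Gal(K̄/K(E[n]))` (`exists_range_absGaloisRestrict_eq_map_conj`)
— acts on `E[2]` through a group of order dividing `[K(E[n]) : L] = 2^k` (`Γ_{K(E[n])} ≤ Γ_{K(E[2])}`,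
`fixingSubgroupOfModule_geomTorsion_le_of_two_dvd`), a `2`-group; a `2`-group of additive permutations of `E[2] ≅ (ℤ/2)²` fixes a subgroup
`C ≠ 0` pointwise and acts trivially on `E[2]/C` (bsd-potss-rkm g33's `FineSelmerPExtensionDescent.exists_flag_of_isPGroup`). Verbatim the
group-theoretic half of `FineSelmerPExtensionDescent.fineSelmerInfty_torsion_finite_of_le_divisionField` with `K(E[p])` replaced by `K(E[n])`.
[cite: SerreLocalFields1979, Ch. IX §1 (fixed points of p-groups)] [cite: Lim2017FineSelmer, §3 Thm. 3.5 (hypothesis «F(μ_{2p}, T/𝔪T) in a finite p-extension of L»)]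
[cite: SilvermanAEC2009, VIII.§1] -/
theorem exists_flag_of_le_divisionField (L : IntermediateField K (AlgebraicClosure K)) {n : ℕ} [NeZero n] (hn : 2 ∣ n)
    (hL : L ≤ W.divisionField n) (k : ℕ) (hk : Module.finrank K (W.divisionField n) = 2 ^ k * Module.finrank K L) :
    ∃ C : AddSubgroup (geomTorsion W ((2 : ℕ) : ℤ)),
      (∀ (σ : absoluteGaloisGroup L) (Q : geomTorsion W ((2 : ℕ) : ℤ)), Q ∈ C → resGal (K := K) L σ • Q = Q) ∧
        ∀ (σ : absoluteGaloisGroup L) (Q : geomTorsion W ((2 : ℕ) : ℤ)), resGal (K := K) L σ • Q - Q ∈ C := by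
  haveI : Fact (Nat.Prime 2) := ⟨Nat.prime_two⟩
  haveI : IsGalois K (AlgebraicClosure K) := {}
  -- the module `E[2]`
  haveI hfinM : Finite (geomTorsion W ((2 : ℕ) : ℤ)) := W.finite_geomTorsion_nat two_ne_zero
  have hV : Nat.card (geomTorsion W ((2 : ℕ) : ℤ)) = 2 ^ 2 := W.natCard_geomTorsion_eq_sq_of_charZero Nat.prime_two
  -- the field `L`
  haveI : FiniteDimensional K L :=
    Module.Finite.of_injective (IntermediateField.inclusion hL).toLinearMap (IntermediateField.inclusion_injective hL)
  -- `res Γ_L` is conjugate to `Gal(K̄/L)`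
  obtain ⟨τ, hτ⟩ := exists_range_absGaloisRestrict_eq_map_conj (F := K) L
  set Γ' : Subgroup (absoluteGaloisGroup K) := (galFixing K L).map (MulAut.conj τ).toMonoidHom with hΓ'def
  have hmemΓ' : ∀ σ : absoluteGaloisGroup L, absGaloisRestrict K L σ ∈ Γ' := fun σ ↦ by
    rw [← hτ]; exact ⟨σ, rfl⟩
  let Φ : absoluteGaloisGroup K →* Equiv.Perm (geomTorsion W ((2 : ℕ) : ℤ)) :=
    MulAction.toPermHom (absoluteGaloisGroup K) (geomTorsion W ((2 : ℕ) : ℤ))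
  have hΦ : ∀ (σ : absoluteGaloisGroup K) (m : geomTorsion W ((2 : ℕ) : ℤ)), Φ σ m = σ • m := fun _ _ ↦ rfl
  set G : Subgroup (Equiv.Perm (geomTorsion W ((2 : ℕ) : ℤ))) := Γ'.map Φ with hGdef
  have hadd : ∀ g ∈ G, ∀ x y : geomTorsion W ((2 : ℕ) : ℤ), g (x + y) = g x + g y := by
    rintro _ ⟨σ, -, rfl⟩ x y
    rw [hΦ, hΦ, hΦ, smul_add]
  -- `ker Φ = Γ_{K(E[2])} ⊇ Γ_{K(E[n])}`
  set Fx2 : Subgroup (absoluteGaloisGroup K) := fixingSubgroupOfModule K (geomTorsion W ((2 : ℕ) : ℤ)) with hFx2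
  set Fxn : Subgroup (absoluteGaloisGroup K) := fixingSubgroupOfModule K (geomTorsion W (n : ℤ)) with hFxn
  have hker : Φ.ker = Fx2 := by
    ext σ
    rw [MonoidHom.mem_ker, hFx2, W.mem_fixingSubgroupOfModule_geomTorsion_iff, Equiv.ext_iff]
    exact Iff.rfl
  have hn2 : Fxn ≤ Fx2 := fixingSubgroupOfModule_geomTorsion_le_of_two_dvd W hn
  haveI hFxnn : Fxn.Normal := W.fixingSubgroupOfModule_geomTorsion_normal n
  have hgF : galFixing K L = (L.fixingSubgroup : Subgroup (absoluteGaloisGroup K)) := by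
    ext σ
    rw [mem_galFixing_iff]
    exact (IntermediateField.mem_fixingSubgroup_iff L (absoluteGaloisGroup.toAlgEquiv K σ)).symm
  have hFxle : Fxn ≤ galFixing K L := by
    intro σ hσ
    rw [hFxn, ← W.fixingSubgroup_divisionField n] at hσ
    rw [mem_galFixing_iff]
    intro x hx
    exact (IntermediateField.mem_fixingSubgroup_iff _ (absoluteGaloisGroup.toAlgEquiv K σ)).1 hσ x (hL hx)
  have hFxconj : Fxn.map (MulAut.conj τ).toMonoidHom = Fxn := by
    ext x
    constructor
    · rintro ⟨y, hy, rfl⟩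
      exact hFxnn.conj_mem y hy τ
    · intro hx
      refine ⟨τ⁻¹ * x * τ⁻¹⁻¹, hFxnn.conj_mem x hx τ⁻¹, ?_⟩
      simp only [MulEquiv.coe_toMonoidHom, MulAut.conj_apply, inv_inv]
      group
  have hFxnΓ' : Fxn ≤ Γ' := by
    rw [← hFxconj, hΓ'def]
    exact Subgroup.map_mono hFxle
  -- `[Γ' : Γ_{K(E[n])}] = 2^k`
  have hrel : Fxn.relIndex Γ' = 2 ^ k := by
    have h1 : Fxn.relIndex Γ' = Fxn.relIndex (galFixing K L) := by
      rw [hΓ'def]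
      conv_lhs => rw [← hFxconj]
      exact Subgroup.relIndex_map_map_of_injective _ _ (MulAut.conj τ).injective
    have h2 : Fxn.relIndex (galFixing K L) * (galFixing K L).index = Fxn.index :=
      Subgroup.relIndex_mul_index hFxle
    have h3 : (galFixing K L).index = Module.finrank K L := by
      rw [hgF]; exact (IntermediateField.finrank_eq_fixingSubgroup_index L).symm
    have h4 : Fxn.index = Module.finrank K (W.divisionField n) := (W.finrank_divisionField (p := n)).symm
    rw [h3, h4, hk] at h2
    rw [h1]
    exact Nat.eq_of_mul_eq_mul_right Module.finrank_pos h2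
  -- `#G = [Γ' : Γ' ⊓ Γ_{K(E[2])}]` divides `[Γ' : Γ_{K(E[n])}] = 2^k`
  have hcardG : Nat.card G = (Fx2 ⊓ Γ').relIndex Γ' := by
    rw [hGdef, ← Subgroup.relIndex_ker, hker, Subgroup.inf_relIndex_right]
  have hdvd : Nat.card G ∣ 2 ^ k := by
    rw [hcardG, ← hrel, ← Subgroup.relIndex_mul_relIndex Fxn (Fx2 ⊓ Γ') Γ' (le_inf hn2 hFxnΓ') inf_le_right]
    exact Dvd.intro_left _ rfl
  obtain ⟨j, -, hj⟩ := (Nat.dvd_prime_pow Nat.prime_two).1 hdvd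
  have hG : IsPGroup 2 G := IsPGroup.of_card hj
  obtain ⟨C, -, hC1', hC2'⟩ := FineSelmerPExtensionDescent.exists_flag_of_isPGroup G hG hadd hV
  have hresG : ∀ σ : absoluteGaloisGroup L, Φ (absGaloisRestrict K L σ) ∈ G :=
    fun σ ↦ ⟨absGaloisRestrict K L σ, hmemΓ' σ, rfl⟩
  refine ⟨C, fun σ m hm ↦ ?_, fun σ m ↦ ?_⟩
  · rw [resGal_eq_absGaloisRestrict, ← hΦ]
    exact hC1' _ (hresG σ) m hm
  · rw [resGal_eq_absGaloisRestrict, ← hΦ]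
    exact hC2' _ (hresG σ) m

/-- **Statement (A) at `(E, 2)` from `μ₂(L^{cyc}) = 0` for every TOTALLY COMPLEX `L ⊆ K(E[n])`, `2 ∣ n`, of `2`-power index** (`∃ γ D`
form; any number field `K`): §1 with the flag of `exists_flag_of_le_divisionField`. This is Lim's Thm. 3.5 at `p = 2` in its honest kernel
scope («`F(μ₄, E[2])` has no real primes»: here the carrier itself has none). [cite: Lim2017FineSelmer, §3 Thm. 3.5, Lemma 3.2 and proof of Thm. 3.1 (arXiv:1306.2047 pp. 6–7)]
[cite: CoatesSujatha2005, statement (A), §3 Thm. 3.4] [cite: Iwasawa1973MuInvariants, Thm. 2/3 («let k be totally imaginary if ℓ = 2»; NOT used)] -/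
theorem exists_fineSelmerDualData_moduleFinite_of_classicalMu_of_le_divisionField
    (L : IntermediateField K (AlgebraicClosure K)) {n : ℕ} [NeZero n] (hn : 2 ∣ n) (hL : L ≤ W.divisionField n)
    (hk : ∃ k : ℕ, Module.finrank K (W.divisionField n) = 2 ^ k * Module.finrank K L)
    (hLc : ∀ w : InfinitePlace L, w.IsComplex)
    (hμ : ∀ κL : ZpExtension L 2, κL.IsCyclotomic → ClassicalMuVanishes κL)
    (κ : ZpExtension K 2) (hκ : κ.IsCyclotomic) :
    ∃ (γ : absoluteGaloisGroup K) (D : W.FineSelmerDualData κ γ),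
      Module.Finite ℤ_[2] (RestrictScalars ℤ_[2] (IwasawaAlgebra 2) D.X) := by
  haveI : FiniteDimensional K L :=
    Module.Finite.of_injective (IntermediateField.inclusion hL).toLinearMap (IntermediateField.inclusion_injective hL)
  obtain ⟨k, hk⟩ := hk
  obtain ⟨C, hC1, hC2⟩ := exists_flag_of_le_divisionField W L hn hL k hk
  exact exists_fineSelmerDualData_moduleFinite_of_classicalMu_of_unipotent W L hLc C hC1 hC2 hμ κ hκ

/-- The RELAXED-at-`∞` form under the same hypotheses: `Sel₀^{rel ∞}(K_∞, E[2^∞])[2]` is finite (B7′'s currency).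
[cite: Lim2017FineSelmer, §3 Thm. 3.5 and Lemma 3.2] [cite: GreenbergLNM1716, §4 Lemma 4.6 (the archimedean Λ/2Λ's)] -/
theorem finite_twoTorsion_fineRelaxed_of_classicalMu_of_le_divisionField
    (L : IntermediateField K (AlgebraicClosure K)) {n : ℕ} [NeZero n] (hn : 2 ∣ n) (hL : L ≤ W.divisionField n)
    (hk : ∃ k : ℕ, Module.finrank K (W.divisionField n) = 2 ^ k * Module.finrank K L)
    (hLc : ∀ w : InfinitePlace L, w.IsComplex)
    (hμ : ∀ κL : ZpExtension L 2, κL.IsCyclotomic → ClassicalMuVanishes κL)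
    (κ : ZpExtension K 2) (hκ : κ.IsCyclotomic) :
    Set.Finite {s : W.fineSelmerInftyRelaxedInf κ | 2 • s = 0} := by
  haveI : FiniteDimensional K L :=
    Module.Finite.of_injective (IntermediateField.inclusion hL).toLinearMap (IntermediateField.inclusion_injective hL)
  obtain ⟨k, hk⟩ := hk
  obtain ⟨C, hC1, hC2⟩ := exists_flag_of_le_divisionField W L hn hL k hk
  exact finite_twoTorsion_fineRelaxed_of_classicalMu_of_unipotent W L hLc C hC1 hC2 hμ κ hκ

/-- **Statement (A) at `(E, 2)` from `μ₂ = 0` of the cyclotomic `ℤ₂`-extension of the `2`-DIVISION FIELD `K(E[2])` ITSELF, whenever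
`K(E[2])` is totally complex** (`n = 2`, `k = 0`: no `√−1` adjoined, no Lim fact, no ascent). Over `ℚ` this is the half-cell `Δ_E < 0`
(§3). [cite: Lim2017FineSelmer, §3 Thm. 3.5 and Lemma 3.2] [cite: CoatesSujatha2005, statement (A), §3 Thm. 3.4] -/
theorem exists_fineSelmerDualData_moduleFinite_of_classicalMu_divisionField_two
    (hc : ∀ w : InfinitePlace (W.divisionField 2), w.IsComplex)
    (hμ : ∀ κF : ZpExtension (W.divisionField 2) 2, κF.IsCyclotomic → ClassicalMuVanishes κF)
    (κ : ZpExtension K 2) (hκ : κ.IsCyclotomic) :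
    ∃ (γ : absoluteGaloisGroup K) (D : W.FineSelmerDualData κ γ),
      Module.Finite ℤ_[2] (RestrictScalars ℤ_[2] (IwasawaAlgebra 2) D.X) :=
  haveI : NeZero (2 : ℕ) := ⟨two_ne_zero⟩
  exists_fineSelmerDualData_moduleFinite_of_classicalMu_of_le_divisionField W (W.divisionField 2) (dvd_refl 2) le_rfl
    ⟨0, by rw [pow_zero, one_mul]⟩ hc hμ κ hκ

end DivisionField

end Summit.BirchSwinnertonDyer.BirchSwinnertonDyer.Theorems.SteinbergFibreAtTwo.TotallyComplexMu

end
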